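import Literature.NumberTheory.Transcendental.BakerCoefficientForm
import Summits.KontsevichZagierPeriods.KontsevichZagierPeriods.Theorems.InverseLandauTateLiftingBakerDecomposition

/-!
# `StokesGeneration` (stmt-KontsevichZagierPeriods-3586) — line `fibrewise_stokes`, stub `stub_rungMixedBaker`

Registered rung stub R8 (rung 3) of the line `fibrewise_stokes` of the crux `StokesGeneration`
(route UnfoldedStokes): **Baker's theorem for real logarithms AND angles, decomposition form,
without an independence hypothesis.** If `ε₁, …, ε_s > 0` are real algebraic,
`θ₁, …, θ_{s'}` are real with `e^{iθ_k}` algebraic, `r, Cᵢ, D_k` are real algebraic and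
`r + Σᵢ Cᵢ log εᵢ + Σ_k D_k θ_k = 0`, then `r = 0`, and the coefficient vector `(C, D)` is a
real-algebraic linear combination of INTEGER vectors `(M_q, N_q)` with `Πᵢ εᵢ^{M_q i} = 1`
(multiplicative relations) and `Σ_k N_q k θ_k = 0` (integer angle relations, exactly `0`).

Proof (the homogeneous real-logarithm decomposition
`Summit.KontsevichZagierPeriods.InverseLandau.tateLifting_bakerDecomposition`, whose folklore
helpers are imported and reused, run on the MIXED real family `v = (log εᵢ)ᵢ ⊔ (θ_k)_k` indexed by
`Fin s ⊕ Fin s'`).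

1. `rungMixed_bakerIndep` — Baker's Theorem 2.1 in coefficient form for a `ℚ`-linearly independent
   subfamily of `v`: complexify to the logarithms `L = (log εᵢ)ᵢ ⊔ (iθ_k)_k` of the algebraic
   numbers `εᵢ`, `e^{iθ_k}` (`re L + im L = v`, so `ℚ`-independence lifts from `v` to `L`), read the
   real relation `β₀ + Σ a_j v_j = 0` in `ℂ` as `β₀ + Σ (a_j τ_j) L_j = 0` with the algebraic twist
   `τ = 1 ⊔ (−i)`, and apply the proved
   `Literature.NumberTheory.Transcendental.baker_coeff_eq_zero`.
2. `rungMixed_eq_zero_of_isAlgebraic_exp` — for real `x`, `e^x` and `e^{ix}` both algebraic force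
   `x = 0` (Gelfond–Schneider `α^i`, here from `baker_coeff_eq_zero` at the pair `x, ix`); hence
   `rungMixed_split`: an INTEGER relation `Σ_μ m_μ v_μ = 0` splits into `Σᵢ mᵢ log εᵢ = 0` and
   `Σ_k m_k θ_k = 0` (`x := Σᵢ mᵢ log εᵢ = −Σ_k m_k θ_k` has `e^x = Π εᵢ^{mᵢ}` and
   `e^{ix} = Π (e^{iθ_k})^{−m_k}` algebraic).
3. The registered statement: maximal `ℚ`-independent subfamily `(v_j)_{j ∈ J}`
   (`tateLifting_exists_finset_linearIndependent`), rational coordinates `ρ_μj`, Baker (1) kills `r`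
   and every column sum `Σ_μ w_μ ρ_μj`; a common denominator `Dd` (`tateLifting_exists_int_mul_eq`)
   gives the integer relations `R_μ = Dd e_μ − Σ_j n_μj e_j`, split by (2) into a multiplicative
   relation (`tateLifting_prod_zpow_eq_one`) and an angle relation; `w = Σ_μ (w_μ / Dd) R_μ` is
   linear algebra; reindex `Fin s ⊕ Fin s' ≃ Fin (s + s')` (`finSumFinEquiv`).

Reference: A. Baker, *Transcendental Number Theory*, Cambridge Univ. Press (1975), Ch. 2,
Theorem 2.1.
-/

noncomputable section

-- `Summit.KontsevichZagierPeriods.KontsevichZagierPeriods.…` is the tree's mandated layout (single-conjunct summit).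
set_option linter.dupNamespace false

namespace Summit.KontsevichZagierPeriods.KontsevichZagierPeriods.Cruxes.StokesGeneration.FibrewiseStokes

open Literature.NumberTheory.Transcendental
open Summit.KontsevichZagierPeriods.InverseLandau (tateLifting_exists_finset_linearIndependent
  tateLifting_exists_int_mul_eq tateLifting_prod_zpow_eq_one)

/-! ### Baker's theorem for the mixed family of real logarithms and angles -/

/-- **Baker's Theorem 2.1 for real logarithms and angles, coefficient form.** Let `εᵢ > 0` be real
algebraic, `θ_k` real with `e^{iθ_k}` algebraic, and `v = (log εᵢ)ᵢ ⊔ (θ_k)_k` the mixed real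
family. If a subfamily `v ∘ f` is `ℚ`-linearly independent and `β₀ + Σ_j a_j v (f j) = 0` with
real algebraic `β₀, a_j`, then `β₀ = 0` and every `a_j = 0`: complexify to the logarithms
`L = (log εᵢ)ᵢ ⊔ (iθ_k)_k` of algebraic numbers (`re L + im L = v` transfers the
`ℚ`-independence), read the relation as `β₀ + Σ_j (a_j τ_j) L_j = 0` with the algebraic twist
`τ = 1 ⊔ (−i)`, and apply `baker_coeff_eq_zero`. [cite: Baker1975, Thm 2.1] -/
theorem rungMixed_bakerIndep {s s' : ℕ} {ε : Fin s → ℝ} {θ : Fin s' → ℝ} (hε : ∀ i, 0 < ε i)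
    (hεa : ∀ i, IsAlgebraic ℚ (ε i))
    (hθa : ∀ k, IsAlgebraic ℚ (Complex.exp ((θ k : ℂ) * Complex.I))) {κ : Type*} [Fintype κ]
    (f : κ → Fin s ⊕ Fin s')
    (hli : LinearIndependent ℚ fun j => Sum.elim (fun i => Real.log (ε i)) θ (f j))
    {β₀ : ℝ} {a : κ → ℝ} (hβ₀ : IsAlgebraic ℚ β₀) (ha : ∀ j, IsAlgebraic ℚ (a j))
    (h : β₀ + ∑ j, a j * Sum.elim (fun i => Real.log (ε i)) θ (f j) = 0) :
    β₀ = 0 ∧ ∀ j, a j = 0 := by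
  -- the complex logarithms `L` and the twist `τ`: `τ L = v` and `re L + im L = v`
  set v : Fin s ⊕ Fin s' → ℝ := Sum.elim (fun i => Real.log (ε i)) θ with hv
  let L : Fin s ⊕ Fin s' → ℂ :=
    Sum.elim (fun i => ((Real.log (ε i) : ℝ) : ℂ)) fun k => (θ k : ℂ) * Complex.I
  let τ : Fin s ⊕ Fin s' → ℂ := Sum.elim (fun _ => 1) fun _ => -Complex.I
  have hτL : ∀ μ, τ μ * L μ = (v μ : ℂ) := by
    rintro (i | k)
    · simp [τ, L, hv]
    · simp only [τ, L, hv, Sum.elim_inr]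
      linear_combination (-(θ k : ℂ)) * Complex.I_sq
  have hreim : ∀ μ, (L μ).re + (L μ).im = v μ := by
    rintro (i | k) <;> simp [L, hv]
  have hI : IsAlgebraic ℚ Complex.I :=
    IsAlgebraic.of_pow two_pos (by rw [Complex.I_sq]; exact isAlgebraic_one.neg)
  have hτa : ∀ μ, IsAlgebraic ℚ (τ μ) := by
    rintro (i | k)
    exacts [isAlgebraic_one, hI.neg]
  have hτ0 : ∀ μ, τ μ ≠ 0 := by
    rintro (i | k)
    exacts [one_ne_zero, neg_ne_zero.mpr Complex.I_ne_zero]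
  have hLa : ∀ μ, IsAlgebraic ℚ (Complex.exp (L μ)) := by
    rintro (i | k)
    · simp only [L, Sum.elim_inl]
      rw [← Complex.ofReal_exp, Real.exp_log (hε i)]
      exact (hεa i).algebraMap
    · exact hθa k
  -- `ℚ`-independence of the complex subfamily
  have hliL : LinearIndependent ℚ fun j => L (f j) := by
    refine LinearIndependent.of_comp
      (Complex.reLm.restrictScalars ℚ + Complex.imLm.restrictScalars ℚ) ?_
    convert hli using 1
    funext j
    simp [hreim]
  -- Baker's theorem, coefficient form, for the relation read in `ℂ`
  have hrel : (β₀ : ℂ) + ∑ j, (a j : ℂ) * τ (f j) * L (f j) = 0 := by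
    simp only [mul_assoc, hτL]
    exact_mod_cast h
  obtain ⟨h0, hj⟩ := baker_coeff_eq_zero (fun j => L (f j)) (fun j => hLa (f j)) hliL
    (β₀ := (β₀ : ℂ)) (β := fun j => (a j : ℂ) * τ (f j)) hβ₀.algebraMap
    (fun j => (ha j).algebraMap.mul (hτa (f j))) hrel
  refine ⟨Complex.ofReal_eq_zero.mp h0, fun j => ?_⟩
  have hj' : (a j : ℂ) * τ (f j) = 0 := hj j
  exact Complex.ofReal_eq_zero.mp ((mul_eq_zero.mp hj').resolve_right (hτ0 (f j)))

/-! ### Integer relations split into a multiplicative relation and an angle relation -/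

/-- **`e^x` and `e^{ix}` are not both algebraic unless `x = 0`** (`x` real; the Gelfond–Schneider
corollary `α ∈ ℚ̄, α ≠ 1 ⟹ α^i ∉ ℚ̄`), from Baker's Theorem 2.1 in coefficient form: for `x ≠ 0` the
pair `x, ix` is `ℚ`-linearly independent with algebraic exponentials, yet `i·x + (−1)·(ix) = 0` is a
nontrivial relation with algebraic coefficients. [cite: Baker1975, Thm 2.1] -/
theorem rungMixed_eq_zero_of_isAlgebraic_exp {x : ℝ} (h1 : IsAlgebraic ℚ (Real.exp x))
    (h2 : IsAlgebraic ℚ (Complex.exp ((x : ℂ) * Complex.I))) : x = 0 := by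
  by_contra hx
  have halg : ∀ j, IsAlgebraic ℚ (Complex.exp (![(x : ℂ), (x : ℂ) * Complex.I] j)) :=
    Fin.forall_fin_two.mpr
      ⟨by rw [Matrix.cons_val_zero, ← Complex.ofReal_exp]; exact h1.algebraMap, h2⟩
  have hli : LinearIndependent ℚ ![(x : ℂ), (x : ℂ) * Complex.I] := by
    refine LinearIndependent.pair_iff.mpr fun p q hpq => ⟨?_, ?_⟩
    · have hre := congrArg Complex.re hpq
      simp only [Complex.add_re, Complex.smul_re, Complex.ofReal_re, Complex.mul_re,
        Complex.I_re, Complex.I_im, Complex.ofReal_im, mul_zero, zero_mul, sub_zero, smul_zero,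
        add_zero, Complex.zero_re] at hre
      exact (smul_eq_zero.mp hre).resolve_right hx
    · have him := congrArg Complex.im hpq
      simp only [Complex.add_im, Complex.smul_im, Complex.ofReal_im, Complex.mul_im,
        Complex.I_re, Complex.I_im, Complex.ofReal_re, mul_zero, mul_one, add_zero, smul_zero,
        zero_add, Complex.zero_im] at him
      exact (smul_eq_zero.mp him).resolve_right hx
  have hI : IsAlgebraic ℚ Complex.I :=
    IsAlgebraic.of_pow two_pos (by rw [Complex.I_sq]; exact isAlgebraic_one.neg)
  have hβ : ∀ j, IsAlgebraic ℚ (![Complex.I, -1] j) :=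
    Fin.forall_fin_two.mpr ⟨hI, isAlgebraic_one.neg⟩
  have h := (baker_coeff_eq_zero _ halg hli isAlgebraic_zero hβ (by
    simp only [Fin.sum_univ_two, Matrix.cons_val_zero, Matrix.cons_val_one]; ring)).2 1
  simp at h

/-- **An integer relation among real logarithms and angles splits.** If `εᵢ > 0` are real algebraic,
`θ_k` are real with `e^{iθ_k}` algebraic, and `Σᵢ mᵢ log εᵢ + Σ_k m_k θ_k = 0` with INTEGERS
`mᵢ, m_k`, then `Σᵢ mᵢ log εᵢ = 0` and `Σ_k m_k θ_k = 0`: `x := Σᵢ mᵢ log εᵢ = −Σ_k m_k θ_k` has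
`e^x = Πᵢ εᵢ^{mᵢ}` and `e^{ix} = Π_k (e^{iθ_k})^{−m_k}` algebraic, so `x = 0`
(`rungMixed_eq_zero_of_isAlgebraic_exp`). [cite: Baker1975, Thm 2.1] -/
theorem rungMixed_split {s s' : ℕ} {ε : Fin s → ℝ} {θ : Fin s' → ℝ} (hε : ∀ i, 0 < ε i)
    (hεa : ∀ i, IsAlgebraic ℚ (ε i))
    (hθa : ∀ k, IsAlgebraic ℚ (Complex.exp ((θ k : ℂ) * Complex.I))) (m : Fin s ⊕ Fin s' → ℤ)
    (h : ∑ μ, (m μ : ℝ) * Sum.elim (fun i => Real.log (ε i)) θ μ = 0) :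
    ∑ i, (m (Sum.inl i) : ℝ) * Real.log (ε i) = 0 ∧ ∑ k, (m (Sum.inr k) : ℝ) * θ k = 0 := by
  rw [Fintype.sum_sum_type] at h
  simp only [Sum.elim_inl, Sum.elim_inr] at h
  set x := ∑ i, (m (Sum.inl i) : ℝ) * Real.log (ε i) with hx
  -- `e^x = Π εᵢ^{mᵢ}` is algebraic
  have hP : 0 < ∏ i, ε i ^ m (Sum.inl i) := Finset.prod_pos fun i _ => zpow_pos (hε i) _
  have h1 : IsAlgebraic ℚ (Real.exp x) := by
    have hlog : Real.log (∏ i, ε i ^ m (Sum.inl i)) = x := by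
      rw [hx, Real.log_prod fun i _ => (zpow_pos (hε i) _).ne']
      simp only [Real.log_zpow]
    rw [← hlog, Real.exp_log hP]
    exact mem_algebraicClosure_iff.mp
      (prod_mem fun i _ => zpow_mem (mem_algebraicClosure_iff.mpr (hεa i)) _)
  -- `e^{ix} = Π (e^{iθ_k})^{-m_k}` is algebraic
  have h2 : IsAlgebraic ℚ (Complex.exp ((x : ℂ) * Complex.I)) := by
    have hxy : x = -∑ k, (m (Sum.inr k) : ℝ) * θ k := eq_neg_of_add_eq_zero_left h
    have hsum : (x : ℂ) * Complex.I =
        ∑ k, ((-m (Sum.inr k) : ℤ) : ℂ) * ((θ k : ℂ) * Complex.I) := by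
      rw [hxy]
      push_cast
      simp only [neg_mul, Finset.sum_mul, mul_assoc, Finset.sum_neg_distrib]
    rw [hsum, Complex.exp_sum]
    simp only [Complex.exp_int_mul]
    exact mem_algebraicClosure_iff.mp
      (prod_mem fun k _ => zpow_mem (mem_algebraicClosure_iff.mpr (hθa k)) _)
  have hx0 : x = 0 := rungMixed_eq_zero_of_isAlgebraic_exp h1 h2
  refine ⟨hx0, ?_⟩
  rwa [hx0, zero_add] at h

/-! ### The registered stub -/

/-- **Registered stub `stub_rungMixedBaker` (rung 3, R8): Baker for real logarithms AND angles,
decomposition form.** If `εᵢ > 0` are real algebraic, `θ_k` real with `e^{iθ_k}` algebraic,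
`r, Cᵢ, D_k` real algebraic and `r + Σᵢ Cᵢ log εᵢ + Σ_k D_k θ_k = 0`, then `r = 0` and there are
integer vectors `(M_q, N_q)` with `Πᵢ εᵢ^{M_q i} = 1`, `Σ_k N_q k θ_k = 0` and real algebraic `c_q`
with `C = Σ_q c_q M_q`, `D = Σ_q c_q N_q`: Baker's Theorem 2.1 (`rungMixed_bakerIndep`) on a maximal
`ℚ`-independent subfamily of the mixed real family `(log εᵢ)ᵢ ⊔ (θ_k)_k` kills `r` and the column
sums of the rational coordinates; clearing denominators gives integer relations
`R_μ = Dd e_μ − Σ_j n_μj e_j`, split into multiplicative and angle relations by `rungMixed_split`,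
and `(C, D) = Σ_μ ((C, D)_μ / Dd) R_μ`. [cite: Baker1975, Thm 2.1] -/
theorem stub_rungMixedBaker :
    ∀ (s s' : ℕ) (ε : Fin s → ℝ) (θ : Fin s' → ℝ) (r : ℝ) (C : Fin s → ℝ) (D : Fin s' → ℝ),
      (∀ i, 0 < ε i) → (∀ i, IsAlgebraic ℚ (ε i)) →
      (∀ k, IsAlgebraic ℚ (Complex.exp ((θ k : ℂ) * Complex.I))) → IsAlgebraic ℚ r →
      (∀ i, IsAlgebraic ℚ (C i)) → (∀ k, IsAlgebraic ℚ (D k)) →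
      r + ∑ i, C i * Real.log (ε i) + ∑ k, D k * θ k = 0 →
      r = 0 ∧ ∃ (t : ℕ) (M : Fin t → Fin s → ℤ) (N : Fin t → Fin s' → ℤ) (c : Fin t → ℝ),
        (∀ q, IsAlgebraic ℚ (c q)) ∧ (∀ q, ∏ i, ε i ^ (M q i) = 1) ∧
        (∀ q, ∑ k, (N q k : ℝ) * θ k = 0) ∧
        (∀ i, C i = ∑ q, c q * (M q i : ℝ)) ∧ (∀ k, D k = ∑ q, c q * (N q k : ℝ)) := by
  intro s s' ε θ r C D hε hεa hθa hra hCa hDa h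
  classical
  -- the mixed real family `v` and its real algebraic weights `w`
  set v : Fin s ⊕ Fin s' → ℝ := Sum.elim (fun i => Real.log (ε i)) θ with hv
  let w : Fin s ⊕ Fin s' → ℝ := Sum.elim C D
  have hwa : ∀ μ, IsAlgebraic ℚ (w μ) := by
    rintro (i | k)
    exacts [hCa i, hDa k]
  have hrel : r + ∑ μ, w μ * v μ = 0 := by
    rw [Fintype.sum_sum_type]
    simpa only [w, hv, Sum.elim_inl, Sum.elim_inr, add_assoc] using h
  -- (1) a maximal `ℚ`-linearly independent subfamily `(v j)_{j ∈ J}`; rational coordinates `ρ`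
  obtain ⟨J, hJli, hJsp⟩ : ∃ J : Finset (Fin s ⊕ Fin s'),
      LinearIndependent ℚ (fun j : J => v j) ∧ ∀ μ, v μ ∈ Submodule.span ℚ (v '' ↑J) :=
    tateLifting_exists_finset_linearIndependent ℚ v
  obtain ⟨ρ, hρJ, hρ⟩ : ∃ ρ : Fin s ⊕ Fin s' → Fin s ⊕ Fin s' → ℚ,
      (∀ μ j, j ∉ J → ρ μ j = 0) ∧ ∀ μ, ∑ j, (ρ μ j : ℝ) * v j = v μ := by
    have hcoef : ∀ μ, ∃ c : Fin s ⊕ Fin s' → ℚ, ∑ j ∈ J, c j • v j = v μ :=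
      fun μ => (Submodule.mem_span_image_finset_iff_exists_fun' ℚ).mp (hJsp μ)
    choose q hq using hcoef
    refine ⟨fun μ j => if j ∈ J then q μ j else 0, fun μ j hj => if_neg hj, fun μ => ?_⟩
    calc ∑ j, ((if j ∈ J then q μ j else 0 : ℚ) : ℝ) * v j
        = ∑ j ∈ J, ((if j ∈ J then q μ j else 0 : ℚ) : ℝ) * v j :=
          (Finset.sum_subset (Finset.subset_univ J) fun j _ hj => by simp [hj]).symm
      _ = ∑ j ∈ J, q μ j • v j := Finset.sum_congr rfl fun j hj => by simp [hj, Rat.smul_def]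
      _ = v μ := hq μ
  -- (2) Baker: `r = 0` and every column sum `Σ_μ w_μ ρ_μj` vanishes
  have hσa : ∀ j, IsAlgebraic ℚ (∑ μ, w μ * (ρ μ j : ℝ)) := fun j =>
    mem_algebraicClosure_iff.mp (sum_mem fun μ _ =>
      mul_mem (mem_algebraicClosure_iff.mpr (hwa μ)) (SubfieldClass.ratCast_mem _ _))
  have h1 : r + ∑ j : J, (∑ μ, w μ * (ρ μ j : ℝ)) * v j = 0 := by
    have hzero : ∀ j ∈ (Finset.univ : Finset (Fin s ⊕ Fin s')), j ∉ J →
        (∑ μ, w μ * (ρ μ j : ℝ)) * v j = 0 := fun j _ hj => by simp [hρJ _ _ hj]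
    have h2 : ∑ j, (∑ μ, w μ * (ρ μ j : ℝ)) * v j = ∑ μ, w μ * v μ := by
      calc ∑ j, (∑ μ, w μ * (ρ μ j : ℝ)) * v j = ∑ μ, w μ * ∑ j, (ρ μ j : ℝ) * v j := by
            simp only [Finset.sum_mul, Finset.mul_sum, mul_assoc]
            exact Finset.sum_comm
        _ = ∑ μ, w μ * v μ := by simp only [hρ]
    rw [Finset.sum_coe_sort J fun j => (∑ μ, w μ * (ρ μ j : ℝ)) * v j,
      Finset.sum_subset (Finset.subset_univ J) hzero, h2]
    exact hrel
  obtain ⟨hr0, hσJ⟩ := rungMixed_bakerIndep hε hεa hθa (Subtype.val : J → Fin s ⊕ Fin s') hJli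
    (a := fun j : J => ∑ μ, w μ * (ρ μ j : ℝ)) hra (fun j => hσa j) h1
  have hσ : ∀ j, ∑ μ, w μ * (ρ μ j : ℝ) = 0 := fun j => by
    by_cases hj : j ∈ J
    · exact hσJ ⟨j, hj⟩
    · simp [hρJ _ _ hj]
  refine ⟨hr0, ?_⟩
  -- (3) clear denominators: the integer relations `R_μ = Dd e_μ − Σ_j n_μj e_j`, split
  obtain ⟨Dd, n, hD, hn⟩ := tateLifting_exists_int_mul_eq ρ
  have hD' : (Dd : ℝ) ≠ 0 := by exact_mod_cast hD
  have hn' : ∀ μ j, ((n μ j : ℤ) : ℝ) = (Dd : ℝ) * (ρ μ j : ℝ) := fun μ j => by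
    exact_mod_cast hn μ j
  let R : Fin s ⊕ Fin s' → Fin s ⊕ Fin s' → ℤ := fun μ ν => (if ν = μ then Dd else 0) - n μ ν
  have hRc : ∀ μ ν, (R μ ν : ℝ) = (if ν = μ then (Dd : ℝ) else 0) - Dd * (ρ μ ν : ℝ) :=
    fun μ ν => by simp only [R, Int.cast_sub, Int.cast_ite, Int.cast_zero, hn']
  have hR : ∀ μ, ∑ ν, (R μ ν : ℝ) * v ν = 0 := fun μ => by
    calc ∑ ν, (R μ ν : ℝ) * v ν = Dd * v μ - Dd * ∑ ν, (ρ μ ν : ℝ) * v ν := by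
          simp only [hRc, sub_mul, Finset.sum_sub_distrib, ite_mul, zero_mul,
            Finset.sum_ite_eq', Finset.mem_univ, if_true, Finset.mul_sum, mul_assoc]
      _ = 0 := by rw [hρ μ, sub_self]
  have hsplit := fun μ => rungMixed_split hε hεa hθa (R μ) (hR μ)
  -- (4) the coefficient identity `w = Σ_μ (w_μ / Dd) R_μ`
  have hcoef : ∀ ν, w ν = ∑ μ, w μ / Dd * (R μ ν : ℝ) := fun ν => by
    symm
    calc ∑ μ, w μ / Dd * (R μ ν : ℝ)
        = ∑ μ, (if ν = μ then w μ else 0) - ∑ μ, w μ * (ρ μ ν : ℝ) := by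
          rw [← Finset.sum_sub_distrib]
          refine Finset.sum_congr rfl fun μ _ => ?_
          rw [hRc, mul_sub, ← mul_assoc, div_mul_cancel₀ _ hD']
          split_ifs
          · rw [div_mul_cancel₀ _ hD']
          · rw [mul_zero]
      _ = w ν := by rw [Finset.sum_ite_eq, if_pos (Finset.mem_univ _), hσ ν, sub_zero]
  -- (5) reindex the relations by `Fin (s + s')`
  let e : Fin (s + s') ≃ Fin s ⊕ Fin s' := finSumFinEquiv.symm
  refine ⟨s + s', fun q i => R (e q) (Sum.inl i), fun q k => R (e q) (Sum.inr k),
    fun q => w (e q) / Dd, fun q => ?_, fun q => ?_, fun q => (hsplit (e q)).2, fun i => ?_,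
    fun k => ?_⟩
  · exact mem_algebraicClosure_iff.mp
      (div_mem (mem_algebraicClosure_iff.mpr (hwa (e q))) (intCast_mem _ Dd))
  · exact tateLifting_prod_zpow_eq_one hε _ (hsplit (e q)).1
  · rw [show C i = w (Sum.inl i) from rfl, hcoef (Sum.inl i)]
    exact (e.sum_comp fun μ => w μ / Dd * (R μ (Sum.inl i) : ℝ)).symm
  · rw [show D k = w (Sum.inr k) from rfl, hcoef (Sum.inr k)]
    exact (e.sum_comp fun μ => w μ / Dd * (R μ (Sum.inr k) : ℝ)).symm

end Summit.KontsevichZagierPeriods.KontsevichZagierPeriods.Cruxes.StokesGeneration.FibrewiseStokes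

end
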